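import Summits.AtomisticToContinuum.Crystallization.Theorems.FrustratedLawDichotomyStrainedPatchHomCutTree

/-!
# SEMANTIC CURRENCY for the `(H)` fcc certificate (the twin of hand-1 g39's `…HomEntrySemantic`): the box verdict `semOKF μ`, cut glue at arbitrary integer cut
# points, box / level antitonicity, the manifest fold, and `(H) HomFloor m` FROM TWO BOOLEANS (27623 `(H) HomFloor`; decomp-a2c hand 2, generation 39)

hand-1 g39's `…HomEntrySemantic` (p854009) made the hcp root fact of record ONE semantic Boolean `semOKH μ rootCH rootWH = true`, glued from sheet-centred cells by
arbitrary integer cuts; hand-2 g39's `…HomCutTree` (p854043) turned the glue into ONE kernel `decide` over a partition manifest.  The fcc root fact of record is still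
tree-shaped — `∃ t, treeOK (entryLeafOK6RBKP4 μ) t rootC rootW = true` (critic row 1468 (A2)) — i.e. a MIDPOINT halving of `rootC ± rootW`.  This module gives the
fcc side the same semantic currency, so landed fcc cells are reusable by containment, cuts may be laid anywhere, and the H-side of the junction of record becomes
TWO Booleans:

* §1 `FccLeafGoal μ U` — the conclusion of `entryLeafOK6RBKP4_sound` (geometric trichotomy for every finite cluster presenting the strained fcc environment, or the
  energy floor `μ/SC`); `semOKF μ c w` — classical `decide` of «the leaf conclusion at every self-adjoint `U` with `‖U − 1‖ ≤ 1/4` in the 9-coordinate box that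
  satisfies the fundamental-domain side conditions `U₁₁ ≤ U₀₀`, `U₂₂ ≤ U₁₁`, `0 ≤ U₀₁`, `0 ≤ U₀₂`» (never evaluated; facts enter through `semOKF_of_…`);
* §2 `semOKF_sound` (tautology, `hver` shape of `fccHalf_of_entryTreeDom`), `semOKF_of_sound`, `semOKF_of_6RBKP` (production fcc verdict), `semOKF_of_6RBKP4`
  (level-closed), `semOKF_mono_level`;
* §3 `semOKF_anti_box`, `semOKF_of_cut` (hand-1's literal `Function.update` form), `semOKF_cut` (`(k, u)` form), `semOKF_of_halves`, `semOKF_of_treeOK`,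
  `semOKF_of_exists_tree4 / _treeP_level`;
* §4 ★ ROOT CONSUMERS: `fccHalf_of_semOKF` (the fcc half from `semOKF μ rootC rootW = true`), ★★★ `homFloor_of_semOKF_semOKH` — `(H) HomFloor m` FROM THE TWO SEMANTIC ROOT
  FACTS (`2 (m + e_W) SC ≤ μ`); `semOKF_root_of_exists_tree4` (the tree-form root hypothesis of record implies the semantic one — nothing typed is lost);
* §5 the MANIFEST FOLD instances of `…HomCutTree`: `semOKF_of_cutOK`, ★ `semOKF_root_of_manifest`, kernel-leaf cut trees `semOKF_of_cutOK_6RBKP_level` / `…6RBKP4`,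
  `semFccFacts_nil/cons/append`.

Two classical definitions (`FccLeafGoal`, `semOKF`); 0 sorry; standard axioms; no instances / notation / `#eval`.  `--supports stmt-AtomisticToContinuum-27623`.
[formal bookkeeping]
-/

noncomputable section

namespace Summit.AtomisticToContinuum.Crystallization.Theorems.FrustratedLawDichotomyStrainedPatchHomEntryLeafHT

open scoped BigOperators RealInnerProductSpace
open Literature.Analysis.ValidatedNumerics.Numerics
open Literature.Barriers.AtomisticToContinuum.FlatleyTheil2015 (fccVec)
open Summit.AtomisticToContinuum.Crystallization.Theorems.ChargedEnergyGapNegative (E3)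
open Summit.AtomisticToContinuum.Crystallization.Theorems.FrustratedLawDichotomySchurCut (effPot w₄₅ ω₄)
open Summit.AtomisticToContinuum.Crystallization.Theorems.FrustratedLawDichotomyAveragingRuleTightFree (TightNearCap BadNearCap)
open Summit.AtomisticToContinuum.Crystallization.Theorems.FrustratedLawDichotomyExemptAbsorption (ExemptNear)
open Summit.AtomisticToContinuum.Crystallization.Theorems.FrustratedLawDichotomyStrainedPatchHomSplit (ExRec latPt HomFloor)
open Summit.AtomisticToContinuum.Crystallization.Theorems.FrustratedLawDichotomyStrainedPatchHomPrunedPolar (homFloor_of_prunedBoxSums_selfAdjoint)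
open Summit.AtomisticToContinuum.Crystallization.Theorems.FrustratedLawDichotomyStrainedPatchHomCertTree (CertTree treeOK)
open Summit.AtomisticToContinuum.Crystallization.Theorems.FrustratedLawDichotomyStrainedPatchHomEntryGram (rootC rootW)
open Summit.AtomisticToContinuum.Crystallization.Theorems.FrustratedLawDichotomyStrainedPatchHomEntryGramHcp (rootCH rootWH)
open Summit.AtomisticToContinuum.Crystallization.Theorems.FrustratedLawDichotomyStrainedPatchHomEntryTableP (entryLeafOK6RBKP entryLeafOK6RBKP_sound)
open Summit.AtomisticToContinuum.Crystallization.Theorems.FrustratedLawDichotomyStrainedPatchHomEntrySign (fccHalf_of_entryTreeDom)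
open Summit.AtomisticToContinuum.Crystallization.Theorems.FrustratedLawDichotomyStrainedPatchHomCutTree (CutTree cutOK cutOK_sound coveredAt
  cutOK_coveredAt_sound)

/-! ## §1. Statement shape and the semantic fcc box verdict -/

/-- The conclusion of the fcc leaf soundness theorems (`entryLeafOK6RBKP4_sound` shape) at level `μ` for the entry matrix `U`: the geometric trichotomy for every
finite cluster presenting the strained fcc environment, or the energy floor `μ/SC`. -/
def FccLeafGoal (μ : ℤ) (U : E3 →L[ℝ] E3) : Prop :=
  (∀ (M : ℕ) (z : Fin M → E3) (cc : Fin M), Function.Injective z →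
      Set.range z = {x : E3 | dist x (z cc) ≤ 133 / 10 ∧ ∃ a : Fin 3 → ℤ, x = z cc + latPt U fccVec a} →
      TightNearCap (9 / 5) (3 / 2) z cc ∨ ExemptNear (9 / 5) ExRec z cc ∨ BadNearCap (9 / 5) (3 / 2) z cc) ∨
    (μ : ℝ) / SC ≤ ∑ b ∈ (Fintype.piFinset fun _ : Fin 3 => Finset.Icc (-7 : ℤ) 7).filter (fun b => b ≠ 0), effPot w₄₅ ω₄ (3 / 400) ‖latPt U fccVec b‖

/-- The leaf conclusion is ANTITONE in the level. [arithmetic] -/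
theorem fccLeafGoal_mono {μ μ' : ℤ} (hle : μ' ≤ μ) {U : E3 →L[ℝ] E3} (h : FccLeafGoal μ U) : FccLeafGoal μ' U := by
  rcases h with h | h
  · exact Or.inl h
  · exact Or.inr ((level_div_SC_mono hle).trans h)

/-- ★ **THE SEMANTIC fcc BOX VERDICT at level `μ`**: the leaf conclusion holds at every self-adjoint `U` with `‖U − 1‖ ≤ 1/4` whose nine entries lie in the box and
which satisfies the fundamental-domain side conditions of the fcc lane (`U₁₁ ≤ U₀₀`, `U₂₂ ≤ U₁₁`, `0 ≤ U₀₁`, `0 ≤ U₀₂`).  Classical `decide`, never evaluated by the kernel: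
facts enter through `semOKF_of_…` below. -/
def semOKF (μ : ℤ) (c w : Fin 3 × Fin 3 → ℤ) : Bool :=
  @decide (∀ U : E3 →L[ℝ] E3, (∀ v v' : E3, ⟪U v, v'⟫ = ⟪v, U v'⟫) → ‖U - 1‖ ≤ 1 / 4 →
      (∀ ab : Fin 3 × Fin 3, |(U (EuclideanSpace.single ab.2 (1 : ℝ))) ab.1 - (c ab : ℝ) / SC| ≤ (w ab : ℝ) / SC) →
      (U (EuclideanSpace.single 1 (1 : ℝ))) 1 ≤ (U (EuclideanSpace.single 0 (1 : ℝ))) 0 →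
      (U (EuclideanSpace.single 2 (1 : ℝ))) 2 ≤ (U (EuclideanSpace.single 1 (1 : ℝ))) 1 →
      0 ≤ (U (EuclideanSpace.single 1 (1 : ℝ))) 0 → 0 ≤ (U (EuclideanSpace.single 2 (1 : ℝ))) 0 → FccLeafGoal μ U) (Classical.propDecidable _)

/-- Introduction: a pointwise proof of the leaf conclusion on the box certifies the box. [formal bookkeeping] -/
theorem semOKF_of_forall {μ : ℤ} {c w : Fin 3 × Fin 3 → ℤ}
    (h : ∀ U : E3 →L[ℝ] E3, (∀ v v' : E3, ⟪U v, v'⟫ = ⟪v, U v'⟫) → ‖U - 1‖ ≤ 1 / 4 →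
      (∀ ab : Fin 3 × Fin 3, |(U (EuclideanSpace.single ab.2 (1 : ℝ))) ab.1 - (c ab : ℝ) / SC| ≤ (w ab : ℝ) / SC) →
      (U (EuclideanSpace.single 1 (1 : ℝ))) 1 ≤ (U (EuclideanSpace.single 0 (1 : ℝ))) 0 →
      (U (EuclideanSpace.single 2 (1 : ℝ))) 2 ≤ (U (EuclideanSpace.single 1 (1 : ℝ))) 1 →
      0 ≤ (U (EuclideanSpace.single 1 (1 : ℝ))) 0 → 0 ≤ (U (EuclideanSpace.single 2 (1 : ℝ))) 0 → FccLeafGoal μ U) : semOKF μ c w = true :=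
  @decide_eq_true _ (Classical.propDecidable _) h

/-- Elimination = ★ **SOUNDNESS in the `hver` shape of `fccHalf_of_entryTreeDom`** (a tautology by construction). [formal bookkeeping] -/
theorem semOKF_sound {μ : ℤ} {c w : Fin 3 × Fin 3 → ℤ} (h : semOKF μ c w = true) (U : E3 →L[ℝ] E3)
    (hsa : ∀ v v' : E3, ⟪U v, v'⟫ = ⟪v, U v'⟫) (hU : ‖U - 1‖ ≤ 1 / 4)
    (hbox : ∀ ab : Fin 3 × Fin 3, |(U (EuclideanSpace.single ab.2 (1 : ℝ))) ab.1 - (c ab : ℝ) / SC| ≤ (w ab : ℝ) / SC)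
    (h1 : (U (EuclideanSpace.single 1 (1 : ℝ))) 1 ≤ (U (EuclideanSpace.single 0 (1 : ℝ))) 0)
    (h2 : (U (EuclideanSpace.single 2 (1 : ℝ))) 2 ≤ (U (EuclideanSpace.single 1 (1 : ℝ))) 1)
    (h01 : 0 ≤ (U (EuclideanSpace.single 1 (1 : ℝ))) 0) (h02 : 0 ≤ (U (EuclideanSpace.single 2 (1 : ℝ))) 0) : FccLeafGoal μ U :=
  @of_decide_eq_true _ (Classical.propDecidable _) h U hsa hU hbox h1 h2 h01 h02

/-! ## §2. Every fcc certificate of the lane is a semantic fact; level antitonicity -/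

/-- ★ A box certified by ANY sound fcc verdict (soundness in the `hver` shape at level `μ`) is semantically certified. [formal bookkeeping] -/
theorem semOKF_of_sound {μ : ℤ} (verdict : (Fin 3 × Fin 3 → ℤ) → (Fin 3 × Fin 3 → ℤ) → Bool)
    (hver : ∀ c w, verdict c w = true → ∀ U : E3 →L[ℝ] E3, (∀ v v' : E3, ⟪U v, v'⟫ = ⟪v, U v'⟫) → ‖U - 1‖ ≤ 1 / 4 →
      (∀ ab : Fin 3 × Fin 3, |(U (EuclideanSpace.single ab.2 (1 : ℝ))) ab.1 - (c ab : ℝ) / SC| ≤ (w ab : ℝ) / SC) →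
      (U (EuclideanSpace.single 1 (1 : ℝ))) 1 ≤ (U (EuclideanSpace.single 0 (1 : ℝ))) 0 →
      (U (EuclideanSpace.single 2 (1 : ℝ))) 2 ≤ (U (EuclideanSpace.single 1 (1 : ℝ))) 1 →
      0 ≤ (U (EuclideanSpace.single 1 (1 : ℝ))) 0 → 0 ≤ (U (EuclideanSpace.single 2 (1 : ℝ))) 0 → FccLeafGoal μ U)
    {c w : Fin 3 × Fin 3 → ℤ} (h : verdict c w = true) : semOKF μ c w = true :=
  semOKF_of_forall fun U hsa hU hbox h1 h2 h01 h02 => hver c w h U hsa hU hbox h1 h2 h01 h02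

/-- ★ A cell passing the production fcc verdict `entryLeafOK6RBKP μ` is semantically certified at level `μ`. [formal bookkeeping] -/
theorem semOKF_of_6RBKP {μ : ℤ} {c w : Fin 3 × Fin 3 → ℤ} (h : entryLeafOK6RBKP μ c w = true) : semOKF μ c w = true :=
  semOKF_of_sound (entryLeafOK6RBKP μ) (fun _ _ hv U hsa hU hbox h1 h2 h01 h02 => entryLeafOK6RBKP_sound hv U hsa hU hbox h1 h2 h01 h02) h

/-- ★ A cell passing the level-closed fcc verdict `entryLeafOK6RBKP4 μ` is semantically certified at level `μ`. [formal bookkeeping] -/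
theorem semOKF_of_6RBKP4 {μ : ℤ} {c w : Fin 3 × Fin 3 → ℤ} (h : entryLeafOK6RBKP4 μ c w = true) : semOKF μ c w = true :=
  semOKF_of_sound (entryLeafOK6RBKP4 μ) (fun _ _ hv U hsa hU hbox h1 h2 h01 h02 => entryLeafOK6RBKP4_sound hv U hsa hU hbox h1 h2 h01 h02) h

/-- ★ The semantic verdict is ANTITONE in the level: a box certified at `μ` is certified at every `μ' ≤ μ` (so `muRec` cells serve `μ₇₄`). [formal bookkeeping] -/
theorem semOKF_mono_level {μ μ' : ℤ} (hle : μ' ≤ μ) {c w : Fin 3 × Fin 3 → ℤ} (h : semOKF μ c w = true) : semOKF μ' c w = true :=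
  semOKF_of_forall fun U hsa hU hbox h1 h2 h01 h02 => fccLeafGoal_mono hle (semOKF_sound h U hsa hU hbox h1 h2 h01 h02)

/-! ## §3. Geometry of boxes: containment, cuts at arbitrary integer points, midpoint trees -/

/-- ★ **BOX ANTITONICITY**: a certified box certifies every box it contains (integer endpoint containment on all nine coordinates). [formal bookkeeping] -/
theorem semOKF_anti_box {μ : ℤ} {c w c' w' : Fin 3 × Fin 3 → ℤ} (hcont : ∀ k, c k - w k ≤ c' k - w' k ∧ c' k + w' k ≤ c k + w k)
    (h : semOKF μ c w = true) : semOKF μ c' w' = true :=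
  semOKF_of_forall fun U hsa hU hbox h1 h2 h01 h02 =>
    semOKF_sound h U hsa hU (fun k => abs_sub_div_le_of_contained (hcont k).1 (hcont k).2 (hbox k)) h1 h2 h01 h02

/-- ★★ **CUT GLUE AT AN ARBITRARY INTEGER CUT POINT** along coordinate `k` (pieces as literal `Function.update`s; side conditions `a − b = c_k − w_k`, `a + b = a' − b'`,
`a' + b' = c_k + w_k`). [formal bookkeeping] -/
theorem semOKF_of_cut {μ : ℤ} {c w cl wl cr wr : Fin 3 × Fin 3 → ℤ} (k : Fin 3 × Fin 3) {a b a' b' : ℤ}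
    (h1 : a - b = c k - w k) (h2 : a + b = a' - b') (h3 : a' + b' = c k + w k)
    (hcl : cl = Function.update c k a) (hwl : wl = Function.update w k b) (hcr : cr = Function.update c k a') (hwr : wr = Function.update w k b')
    (hl : semOKF μ cl wl = true) (hr : semOKF μ cr wr = true) : semOKF μ c w = true := by
  subst hcl hwl hcr hwr
  refine semOKF_of_forall fun U hsa hU hbox hx1 hx2 hx01 hx02 => ?_
  rcases abs_sub_div_le_or_of_cut h1 h2 h3 (hbox k) with hk | hk
  · refine semOKF_sound hl U hsa hU (fun j => ?_) hx1 hx2 hx01 hx02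
    by_cases hj : j = k
    · subst hj; simpa using hk
    · simpa [Function.update_of_ne hj] using hbox j
  · refine semOKF_sound hr U hsa hU (fun j => ?_) hx1 hx2 hx01 hx02
    by_cases hj : j = k
    · subst hj; simpa using hk
    · simpa [Function.update_of_ne hj] using hbox j

/-- The cut in `(k, u)` form (cut point `c_k − w_k + 2u`; the node shape of `…HomCutTree.CutTree`). [formal bookkeeping] -/
theorem semOKF_cut {μ : ℤ} (k : Fin 3 × Fin 3) (u : ℤ) (c w : Fin 3 × Fin 3 → ℤ)
    (hl : semOKF μ (Function.update c k (c k - w k + u)) (Function.update w k u) = true)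
    (hr : semOKF μ (Function.update c k (c k + u)) (Function.update w k (w k - u)) = true) : semOKF μ c w = true :=
  semOKF_of_cut k (a := c k - w k + u) (b := u) (a' := c k + u) (b' := w k - u) (by ring) (by ring) (by ring) rfl rfl rfl rfl hl hr

/-- MIDPOINT HALVING is the special cut `p = c_k` (`w_k` even). [formal bookkeeping] -/
theorem semOKF_of_halves {μ : ℤ} {c w : Fin 3 × Fin 3 → ℤ} (k : Fin 3 × Fin 3) (hev : w k % 2 = 0)
    (hl : semOKF μ (Function.update c k (c k - w k / 2)) (Function.update w k (w k / 2)) = true)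
    (hr : semOKF μ (Function.update c k (c k + w k / 2)) (Function.update w k (w k / 2)) = true) : semOKF μ c w = true := by
  refine semOKF_of_cut k (a := c k - w k / 2) (b := w k / 2) (a' := c k + w k / 2) (b' := w k / 2) ?_ ?_ ?_ rfl rfl rfl rfl hl hr <;> omega

/-- ★ **EVERY CERTIFICATE TREE over a sound fcc verdict is ONE semantic fact on its root box**. [formal bookkeeping] -/
theorem semOKF_of_treeOK {μ : ℤ} (verdict : (Fin 3 × Fin 3 → ℤ) → (Fin 3 × Fin 3 → ℤ) → Bool)
    (hver : ∀ c w, verdict c w = true → ∀ U : E3 →L[ℝ] E3, (∀ v v' : E3, ⟪U v, v'⟫ = ⟪v, U v'⟫) → ‖U - 1‖ ≤ 1 / 4 →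
      (∀ ab : Fin 3 × Fin 3, |(U (EuclideanSpace.single ab.2 (1 : ℝ))) ab.1 - (c ab : ℝ) / SC| ≤ (w ab : ℝ) / SC) →
      (U (EuclideanSpace.single 1 (1 : ℝ))) 1 ≤ (U (EuclideanSpace.single 0 (1 : ℝ))) 0 →
      (U (EuclideanSpace.single 2 (1 : ℝ))) 2 ≤ (U (EuclideanSpace.single 1 (1 : ℝ))) 1 →
      0 ≤ (U (EuclideanSpace.single 1 (1 : ℝ))) 0 → 0 ≤ (U (EuclideanSpace.single 2 (1 : ℝ))) 0 → FccLeafGoal μ U) :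
    ∀ (t : CertTree (Fin 3 × Fin 3)) (c w : Fin 3 × Fin 3 → ℤ), treeOK verdict t c w = true → semOKF μ c w = true
  | .leaf, c, w, h => semOKF_of_sound verdict hver (by simpa [treeOK] using h)
  | .split k l r, c, w, h => by
    simp only [treeOK, Bool.and_eq_true, decide_eq_true_eq] at h
    exact semOKF_of_halves k h.1.1 (semOKF_of_treeOK verdict hver l _ _ h.1.2) (semOKF_of_treeOK verdict hver r _ _ h.2)

/-- ★ The ∃-tree currency over the production fcc verdict at level `μ₀` is a semantic fact at every `μ ≤ μ₀`. [formal bookkeeping] -/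
theorem semOKF_of_exists_treeP_level {μ μ₀ : ℤ} (hle : μ ≤ μ₀) {c w : Fin 3 × Fin 3 → ℤ}
    (h : ∃ t : CertTree (Fin 3 × Fin 3), treeOK (entryLeafOK6RBKP μ₀) t c w = true) : semOKF μ c w = true := by
  obtain ⟨t, ht⟩ := h
  exact semOKF_mono_level hle
    (semOKF_of_treeOK (entryLeafOK6RBKP μ₀) (fun _ _ hv U hsa hU hbox h1 h2 h01 h02 => entryLeafOK6RBKP_sound hv U hsa hU hbox h1 h2 h01 h02) t c w ht)

/-- ★ The ∃-tree currency over the level-closed fcc verdict IS a semantic fact. [formal bookkeeping] -/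
theorem semOKF_of_exists_tree4 {μ : ℤ} {c w : Fin 3 × Fin 3 → ℤ}
    (h : ∃ t : CertTree (Fin 3 × Fin 3), treeOK (entryLeafOK6RBKP4 μ) t c w = true) : semOKF μ c w = true := by
  obtain ⟨t, ht⟩ := h
  exact semOKF_of_treeOK (entryLeafOK6RBKP4 μ) (fun _ _ hv U hsa hU hbox h1 h2 h01 h02 => entryLeafOK6RBKP4_sound hv U hsa hU hbox h1 h2 h01 h02) t c w ht

/-! ## §4. Root consumers: the fcc half and `(H) HomFloor m` from TWO BOOLEANS -/

/-- A semantic root fact is a one-leaf `treeOK` tree over the semantic verdict. [formal bookkeeping] -/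
theorem treeOK_leaf_semOKF {μ : ℤ} {c w : Fin 3 × Fin 3 → ℤ} (h : semOKF μ c w = true) : treeOK (semOKF μ) .leaf c w = true := by
  simpa [treeOK] using h

/-- ★★★ **THE fcc HALF FROM THE ONE SEMANTIC ROOT FACT** `semOKF μ rootC rootW = true` (every `m` with `2 (m + e_W) SC ≤ μ`). [folklore chaining] -/
theorem fccHalf_of_semOKF {m : ℝ} {μ : ℤ} (hμ : 2 * (m + (-(7175 / 10000) + 3 / 400)) * SC ≤ μ) (h : semOKF μ rootC rootW = true) :
    ∀ U : E3 →L[ℝ] E3, (∀ v w : E3, inner ℝ (U v) w = inner ℝ v (U w)) → (∀ w : E3, 0 ≤ inner ℝ w (U w)) → ‖U - 1‖ ≤ 1 / 4 →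
      (∀ (M : ℕ) (z : Fin M → E3) (c : Fin M), Function.Injective z →
          Set.range z = {x : E3 | dist x (z c) ≤ 133 / 10 ∧ ∃ a : Fin 3 → ℤ, x = z c + latPt U fccVec a} →
          TightNearCap (9 / 5) (3 / 2) z c ∨ ExemptNear (9 / 5) ExRec z c ∨ BadNearCap (9 / 5) (3 / 2) z c) ∨
      m ≤ (∑ b ∈ (Fintype.piFinset fun _ : Fin 3 => Finset.Icc (-7 : ℤ) 7).filter (fun b => b ≠ 0),
        effPot w₄₅ ω₄ (3 / 400) ‖latPt U fccVec b‖) / 2 - (-(7175 / 10000) + 3 / 400) :=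
  fccHalf_of_entryTreeDom hμ (semOKF μ) (fun _ _ hv U hsa hU hbox h1 h2 h01 h02 => semOKF_sound hv U hsa hU hbox h1 h2 h01 h02) (treeOK_leaf_semOKF h)

/-- ★★★ **`(H) HomFloor m` FROM THE TWO SEMANTIC ROOT FACTS** `semOKF μ rootC rootW = true` (fcc) and `semOKH μ rootCH rootWH = true` (hcp), at any level `μ` with
`2 (m + e_W) SC ≤ μ` — the H-side of the junction of record as two Booleans, each assemblable from cells by a partition manifold (`…HomCutTree`). [folklore] -/
theorem homFloor_of_semOKF_semOKH {m : ℝ} {μ : ℤ} (hμ : 2 * (m + (-(7175 / 10000) + 3 / 400)) * SC ≤ μ)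
    (hF : semOKF μ rootC rootW = true) (hH : semOKH μ rootCH rootWH = true) : HomFloor m :=
  homFloor_of_prunedBoxSums_selfAdjoint (fccHalf_of_semOKF hμ hF) (hcpHalf_of_semOKH hμ hH)

/-- CONTAINMENT at the root: the tree-shaped fcc root hypothesis of record (v4) yields the semantic one — nothing typed so far is lost. [formal bookkeeping] -/
theorem semOKF_root_of_exists_tree4 {μ : ℤ}
    (hF : ∃ t : CertTree (Fin 3 × Fin 3), treeOK (entryLeafOK6RBKP4 μ) t rootC rootW = true) : semOKF μ rootC rootW = true :=
  semOKF_of_exists_tree4 hF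

/-- … and conversely the semantic root fact IS an ∃-tree fact over the semantic verdict. [formal bookkeeping] -/
theorem exists_tree_semOKF_of_semOKF {μ : ℤ} {c w : Fin 3 × Fin 3 → ℤ} (h : semOKF μ c w = true) :
    ∃ t : CertTree (Fin 3 × Fin 3), treeOK (semOKF μ) t c w = true :=
  ⟨.leaf, treeOK_leaf_semOKF h⟩

/-- `HomFloor m` from the fcc v4 ∃-TREE and the hcp semantic root fact (hand-1's `homFloor_of_entryTree6RBKP4_semOKH`) factors through the two-Boolean form.
[formal bookkeeping] -/
example {m : ℝ} {μ : ℤ} (hμ : 2 * (m + (-(7175 / 10000) + 3 / 400)) * SC ≤ μ)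
    (hF : ∃ t : CertTree (Fin 3 × Fin 3), treeOK (entryLeafOK6RBKP4 μ) t rootC rootW = true) (hH : semOKH μ rootCH rootWH = true) : HomFloor m :=
  homFloor_of_semOKF_semOKH hμ (semOKF_root_of_exists_tree4 hF) hH

/-! ## §5. The manifest fold (`…HomCutTree`) in the fcc currency -/

/-- ★★ **A MANIFEST CERTIFIES ITS ROOT BOX in the fcc semantic currency**: every listed box certified at level `μ` + `cutOK (coveredAt L) t c w = true` (kernel `decide`) ⟹
`semOKF μ c w = true`. [formal bookkeeping] -/
theorem semOKF_of_cutOK {μ : ℤ} (L : List ((Fin 3 × Fin 3 → ℤ) × (Fin 3 × Fin 3 → ℤ))) (hL : ∀ b ∈ L, semOKF μ b.1 b.2 = true) :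
    ∀ (t : CutTree (Fin 3 × Fin 3) ℕ) (c w : Fin 3 × Fin 3 → ℤ), cutOK (coveredAt L) t c w = true → semOKF μ c w = true :=
  cutOK_coveredAt_sound (semOKF μ) (fun _ _ _ _ hc h => semOKF_anti_box hc h) (fun k u c w hl hr => semOKF_cut k u c w hl hr) L hL

/-- ★★★ **THE fcc ROOT FACT FROM A PARTITION MANIFEST** of the root cube `(rootC, rootW)`. [formal bookkeeping] -/
theorem semOKF_root_of_manifest {μ : ℤ} (L : List ((Fin 3 × Fin 3 → ℤ) × (Fin 3 × Fin 3 → ℤ)))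
    (hL : ∀ b ∈ L, semOKF μ b.1 b.2 = true) (t : CutTree (Fin 3 × Fin 3) ℕ) (h : cutOK (coveredAt L) t rootC rootW = true) :
    semOKF μ rootC rootW = true :=
  semOKF_of_cutOK L hL t rootC rootW h

/-- ★ **KERNEL-LEAF CUT TREES over the production fcc verdict** at `μ₀`, arbitrary integer cuts, serving every `μ ≤ μ₀`. [formal bookkeeping] -/
theorem semOKF_of_cutOK_6RBKP_level {μ μ₀ : ℤ} (hle : μ ≤ μ₀) (t : CutTree (Fin 3 × Fin 3) Unit) (c w : Fin 3 × Fin 3 → ℤ)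
    (h : cutOK (fun _ => entryLeafOK6RBKP μ₀) t c w = true) : semOKF μ c w = true :=
  semOKF_mono_level hle
    (cutOK_sound (semOKF μ₀) (fun _ => entryLeafOK6RBKP μ₀) (fun _ _ _ h => semOKF_of_6RBKP h) (fun k u c w hl hr => semOKF_cut k u c w hl hr) t c w h)

/-- Kernel-leaf cut trees over the level-closed fcc verdict. [formal bookkeeping] -/
theorem semOKF_of_cutOK_6RBKP4 {μ : ℤ} :
    ∀ (t : CutTree (Fin 3 × Fin 3) Unit) (c w : Fin 3 × Fin 3 → ℤ), cutOK (fun _ => entryLeafOK6RBKP4 μ) t c w = true → semOKF μ c w = true :=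
  cutOK_sound (semOKF μ) (fun _ => entryLeafOK6RBKP4 μ) (fun _ _ _ h => semOKF_of_6RBKP4 h) (fun k u c w hl hr => semOKF_cut k u c w hl hr)

/-- MIXED LEAVES (listed landed cell `Sum.inl i` or fresh production kernel leaf `Sum.inr ()` at `μ₀ ≥ μ`) in one fcc cut tree. [formal bookkeeping] -/
theorem semOKF_of_cutOK_mixed {μ μ₀ : ℤ} (hle : μ ≤ μ₀) (L : List ((Fin 3 × Fin 3 → ℤ) × (Fin 3 × Fin 3 → ℤ)))
    (hL : ∀ b ∈ L, semOKF μ b.1 b.2 = true) :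
    ∀ (t : CutTree (Fin 3 × Fin 3) (ℕ ⊕ Unit)) (c w : Fin 3 × Fin 3 → ℤ),
      cutOK (fun a c w => Sum.elim (fun i => coveredAt L i c w) (fun _ => entryLeafOK6RBKP μ₀ c w) a) t c w = true → semOKF μ c w = true :=
  cutOK_sound (semOKF μ) _
    (fun a c w h => by
      rcases a with i | u
      · exact cutOK_coveredAt_sound (semOKF μ) (fun _ _ _ _ hc h => semOKF_anti_box hc h) (fun k u c w hl hr => semOKF_cut k u c w hl hr) L hL
          (.leaf i) c w h
      · exact semOKF_mono_level hle (semOKF_of_6RBKP h))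
    (fun k u c w hl hr => semOKF_cut k u c w hl hr)

/-- The empty fcc manifest list is certified. [formal bookkeeping] -/
theorem semFccFacts_nil {μ : ℤ} : ∀ b ∈ ([] : List ((Fin 3 × Fin 3 → ℤ) × (Fin 3 × Fin 3 → ℤ))), semOKF μ b.1 b.2 = true := by
  simp

/-- Cons a landed fcc fact onto a certified manifest list. [formal bookkeeping] -/
theorem semFccFacts_cons {μ : ℤ} {c w : Fin 3 × Fin 3 → ℤ} {L : List ((Fin 3 × Fin 3 → ℤ) × (Fin 3 × Fin 3 → ℤ))}
    (hb : semOKF μ c w = true) (hL : ∀ b ∈ L, semOKF μ b.1 b.2 = true) : ∀ b ∈ ((c, w) :: L), semOKF μ b.1 b.2 = true := by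
  intro b hb'
  rcases List.mem_cons.1 hb' with rfl | h
  · exact hb
  · exact hL b h

/-- Appending two certified fcc manifest lists. [formal bookkeeping] -/
theorem semFccFacts_append {μ : ℤ} {L₁ L₂ : List ((Fin 3 × Fin 3 → ℤ) × (Fin 3 × Fin 3 → ℤ))}
    (h₁ : ∀ b ∈ L₁, semOKF μ b.1 b.2 = true) (h₂ : ∀ b ∈ L₂, semOKF μ b.1 b.2 = true) : ∀ b ∈ L₁ ++ L₂, semOKF μ b.1 b.2 = true := by
  intro b hb
  rcases List.mem_append.1 hb with h | h
  · exact h₁ b h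
  · exact h₂ b h

end Summit.AtomisticToContinuum.Crystallization.Theorems.FrustratedLawDichotomyStrainedPatchHomEntryLeafHT

end
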